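import Summits.BirchSwinnertonDyer.Rank1Residual.Supersingular.X6KimTamDefectShapeLValues
import Summits.BirchSwinnertonDyer.Rank1Residual.Supersingular.X7KuriharaOfferShape
import HarnessLib

/-!
# N5 TAM-DEFECT shapes (class X7, `r_an = 0`, `p ≥ 5`, `surj(p)`, `p ∣ ∏c_ℓ`): `BSD(E,p)` from ONE depth-`k` Kurihara number,
# `k ≤ ord_p ∏c_ℓ + 1` — the X7 twins of x10b gen 13's N4 shapes (`X6KimTamDefectShape.lean`, `X6KimTamDefectShapeLValues.lean`)

Cell `b2b-bsdres`, supersingular family, prover A = unit `b2b-bsdres-x10b` (gen 17; X7 joint pair, A side).  Topic file;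
namespace `Summit.BirchSwinnertonDyer.Rank1Residual.Supersingular`.  THEOREMS ONLY (compositions of tree theorems BY NAME:
n1011/additive `X4.bsdp_rankZero_of_kimLower_of_missingUpperBoundAt`, `PerrinRiou2003.missingUpperBoundAt_of_prop48_of_surj`,
additive-p3's `classX7_of_intModel`, gen 13's `CertifiedK.kuriharaNumber_ne_zero_of_LValueBall` and `CyclicityLadder`); no named
fact, no definition, debt 0; nothing asserted about any curve; nothing booked; X7 stays CONSTRUCTION-SHAPED (RESIDUAL-MAP §I N5).

HONEST FRAMING (run/shared/lean/b2b/bsd-rank1-residual/, verbatim in every file): the goal of the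
cell is to DELETE the COMBINATION-SHAPED residual classes of the Birch–Swinnerton-Dyer formula for
ALL analytic-rank `≤ 1` elliptic curves over `ℚ` — "full BSD formula for every rank `≤ 1` curve in
class `C`" assembled STRICTLY from published theorems — so that the rank-`≤ 1` remainder becomes
exactly the CONSTRUCTION-SHAPED classes, which are TYPED (missing-input `Prop`s), NOT attempted.
This is not "finishing BSD".

## Why

The N5 book (X7 ∧ `r_an = 0`, `p ≥ 5`) has five SURJECTIVE cells with `p ∣ ∏c_ℓ` ("TAM", `ord_p ∏c_ℓ = 1`, `#Ш_an = p²`: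
247104ea1, 377982h1, 484176bh1 @ 5; 194480bt1, 405450dd1 @ 7; `class-closure/N5/RECORD-STATUS-N5-pge5-x10b-g16.tsv`) and no
per-pair theorem of any kind: Kim's Theorem 1.9 (6) at depth 1 (`𝒩₁`, unit route) is void there (`p ∣ ∏c`), and no visibility
partner exists (X7-KURIHARA.md §19).  On N4 (class X6) x10b gen 13 gave the TAM-DEFECT cells a per-pair route from ONE depth-`k`
Kurihara number `δ̃^{(k)}_n ≢ 0 (mod p^k)` at a CYCLIC two-prime level `n = ℓ₁ℓ₂ ∈ 𝒩_k`, `k ≤ ord_p ∏c_ℓ + 1` — lower half Kim 2026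
Thm. 1.9 (6) (PUBLISHED), upper half Perrin-Riou 2003 Prop. 4.8 (PUBLISHED) — and closed 145146q1 @ 5 with it
(`X6KimTamDefectRecordsLValues.lean`).  Both halves are CLASS-FREE given `surj(p)`: on X6 surjectivity is automatic
(`ClassX6.surj`), on X7 it is the per-pair DATA binder `hsurj` (Cremona `galrep`; prover B's kernel certificates
`RankZeroSurjCertificatesX7_*`).  This file writes the X7 twins; two of the five cells (247104ea1, 484176bh1 @ 5) have a depth-2
level `ℓ₁ℓ₂ ∈ 𝒩₂` (`ℓᵢ ≡ 1`, `a_ℓᵢ ≡ 2 (mod 25)`) within reach of implementation 3d (x10b gen 17 kit j166283 / j166284).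

## What this file proves

* §1 `X7RankZero.bsdp_of_kimLower_of_prop48` — class form: `ClassX7 W p`, `Surj W p`, `p ≥ 5`, `r_an = 0`, a modular
  parametrisation datum `D` with `p ∤ c_D` and the period transfer, a cyclic level `n ∈ 𝒩_k` with `1 ≤ k ≤ ord_p ∏c_ℓ + 1`,
  surjective `ψ`, and `kuriharaNumber D.f (p^k) n ψ ≠ 0` ⟹ `BSDp W p`.  Named facts `hKimL` (Kim 2026 Thm 1.9 (6)), `h48`
  (Perrin-Riou 2003 Prop. 4.8) PUBLISHED; `hGZK`, `hmod`.
* §2 `X7RankZero.bsdp_of_kimLower_of_prop48_of_certifiedK_of_LValueBall` — §1 in the cell's STANDARD CURRENCY: `hδ` replaced by a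
  LANDED `CertifiedK` row, its `validHasseK` rounding certificate and the engine's twisted-`L`-value ENCLOSURE `hballL`
  (`CertifiedK.kuriharaNumber_ne_zero_of_LValueBall`; irreducibility from `ClassX7.irr`).
* §3 `X7RankZero.bsdp_of_kimLower_of_prop48_of_ainvs_of_certifiedK_of_LValueBall` — the literal-equation RECORD SHAPE at a
  two-prime level: minimality (instance hypothesis), class X7 read off the model (`classX7_of_intModel`: `p ∤ Δ`, the point count
  at `p`, an ADDITIVE prime `q ∣ Δ`, `q ∣ c₄`), depth-`k` Kolyvagin primes from point counts, CYCLICITY as two per-prime hypotheses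
  in the literal-model form that `CyclicityLadder.lean` certifies (at depth `k ≥ 2` the count is silent), `ψ` any family
  surjective at `ℓ₁, ℓ₂`, and the data binders `hsurj`, `r_an = 0`, `k ≤ ord_p ∏c_ℓ + 1`, `D` with `p ∤ c_D`, `hper`, `hballL`.

References: C.-H. Kim, AJM 148 (2026) Thm. 1.9 (6), §1.2.2, §1.4.3, §1.5.1–1.5.3 [Kim2022StructureSelmer]; B. Perrin-Riou,
Exp. Math. 12 (2003) Prop. 4.8 [PerrinRiou2003]; K. Kato, Astérisque 295 (2004) (12.5.2) [Kato2004Asterisque]; Mazur–Tate–Teitelbaum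
1986 §I.8 [MazurTateTeitelbaum1986Invent]; [SilvermanAEC2009] VII.1, VII.5; [IrelandRosen1990] Prop. 5.1.2; [Miller2011LMS]
Def. 1.1; tree files `X4/KuriharaLowerHalf.lean`, `Supersingular/X6KimTamDefectShape{,LValues}.lean`, `X7KuriharaOfferShape.lean`,
`CyclicityLadder.lean`; X7-KURIHARA.md §20 (HOME/b2b-bsdres-x10b/).
-/

set_option autoImplicit false

noncomputable section

open scoped Classical MatrixGroups ModularForm

open CongruenceSubgroup WeierstrassCurve Literature.NumberTheory.EllipticCurves
  Literature.NumberTheory.EllipticCurves.ModularForms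
  Literature.NumberTheory.EllipticCurves.Rank1Residual
  Literature.NumberTheory.EllipticCurves.Rank1Residual.Typed
  Literature.NumberTheory.EllipticCurves.Rank1Residual.X11RankOneCertificates
  Summit.BirchSwinnertonDyer.BirchSwinnertonDyer.Rank1Residual.IntModel
  Summit.BirchSwinnertonDyer.BirchSwinnertonDyer.Rank1Residual.X11RankOne
  Summit.BirchSwinnertonDyer.Rank1Residual.X11b
  Summit.BirchSwinnertonDyer.Rank1Residual.Additive
  Summit.BirchSwinnertonDyer.Rank1Residual.Supersingular.KuriharaTwist

namespace Summit.BirchSwinnertonDyer.Rank1Residual.Supersingular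

/-! ### §1 The class form -/

/-- **N5 TAM-DEFECT, class form — `BSD(E,p)` on X7 ∧ `surj(p)` ∧ `r_an = 0` ∧ `p ≥ 5` from ONE depth-`k` Kurihara number,
`k ≤ ord_p ∏c_ℓ + 1`.**  Lower half: Kim 2026 Thm. 1.9 (6) (`hKimL`, PUBLISHED; `X4.bsdp_rankZero_of_kimLower_of_missingUpperBoundAt`);
upper half: Perrin-Riou 2003 Prop. 4.8 (`h48`, PUBLISHED; `missingUpperBoundAt_of_prop48_of_surj`); surjectivity of `ρ̄_{E,p}` is the
per-pair DATA binder `hsurj` (on X7 it is not automatic).  Data binders: `D` with `p ∤ c_D`, the period transfer `hper`, the cyclic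
level, `ψ`, `hδ`.  Per pair; NOT a class theorem; nothing booked. [cite: Kim2022StructureSelmer, Thm. 1.9 (6) (PDF p. 8) and §1.5.1–1.5.3 (PDF pp. 7–8)]
[cite: PerrinRiou2003, Prop. 4.8 (p. 162)] [cite: Kato2004Asterisque, (12.5.2) in Thm. 12.5 (4) (p. 222)] [cite: Miller2011LMS, Def. 1.1] -/
theorem X7RankZero.bsdp_of_kimLower_of_prop48 (W : WeierstrassCurve ℚ) [W.IsElliptic] [W.IsGloballyMinimal]
    (p : ℕ) [Fact p.Prime]
    (hKimL : Kim2026.rankZero_le_padicValNat_sha_of_kuriharaNumber_ne_zero)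
    (h48 : PerrinRiou2003.prop48_padicValRat_bsd_rank_zero_le)
    (hGZK : rank_eq_analyticRank_of_analyticRank_le_one) (hmod : hasEntireLFunction_rat)
    (hp5 : 5 ≤ p) (hX : ClassX7 W p) (hsurj : Surj W p) (hr : W.analyticRank = 0)
    {N : ℕ} [NeZero N] (D : ModularParametrizationData W N) (hc : ¬ (p : ℤ) ∣ D.maninConstant)
    (hper : ∃ u : ℚ, ‖(u : ℚ_[p])‖ = 1 ∧ W.realPeriodRat = u * plusPeriod D.f)
    (k n : ℕ) [NeZero n] (hk : 1 ≤ k) (hkt : k ≤ padicValNat p W.tamagawaProduct + 1)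
    (hn : Kato.IsKolyvaginProduct W p k n)
    (hcyc : ∀ (ℓ : ℕ) [Fact ℓ.Prime], ℓ ∣ n →
      Nat.card {P : ((WeierstrassCurve.integralModelInt W).map
          (Int.castRingHom (ZMod ℓ))).toAffine.Point // p • P = 0} ≤ p)
    (ψ : (ℓ : ℕ) → (ZMod ℓ)ˣ →* Multiplicative (ZMod (p ^ k)))
    (hψ : ∀ ℓ ∈ n.primeFactors, Function.Surjective (ψ ℓ))
    (hδ : kuriharaNumber D.f (p ^ k) n ψ ≠ 0) : BSDp W p := by
  have hL : W.entireLFunction 1 ≠ 0 := (W.analyticRank_eq_zero_iff_holds (hmod W)).1 hr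
  exact X4.bsdp_rankZero_of_kimLower_of_missingUpperBoundAt W p hKimL hGZK hp5 hsurj hL D hc hper k n hk hkt hn hcyc ψ
    hψ hδ (PerrinRiou2003.missingUpperBoundAt_of_prop48_of_surj W p h48 hGZK hmod hp5 hX.1 hsurj hr)

/-! ### §2 The class form in the standard currency (`CertifiedK` row + rounding certificate + `L`-value enclosure) -/

/-- **N5 TAM-DEFECT, class form, STANDARD CURRENCY — `BSD(E,p)` on X7 ∧ `surj(p)` ∧ `r_an = 0` ∧ `p ≥ 5` from a LANDED depth-`k`
record (`CertifiedK`), its `validHasseK` rounding certificate and the engine's `L`-value enclosure**, `k ≤ ord_p ∏c_ℓ + 1`: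
`X7RankZero.bsdp_of_kimLower_of_prop48` with `hδ := CertifiedK.kuriharaNumber_ne_zero_of_LValueBall …` (irreducibility from
`ClassX7.irr`, good reduction at `p` from `ClassX7`).  Named facts `hKimL`, `h48` PUBLISHED; `hGZK`, `hmod`.  Per pair; NOT a class
theorem; nothing booked. [cite: Kim2022StructureSelmer, Thm. 1.9 (6) (PDF p. 8), §1.4.3 (PDF p. 7) and §1.5.1–1.5.3 (PDF pp. 7–8)]
[cite: PerrinRiou2003, Prop. 4.8 (p. 162)] [cite: MazurTateTeitelbaum1986Invent, §I.8 (8.6)] [cite: CremonaAlgorithms1997, §2.8 (2.8.8) (PDF p. 26)]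
[cite: Miller2011LMS, Def. 1.1] -/
theorem X7RankZero.bsdp_of_kimLower_of_prop48_of_certifiedK_of_LValueBall
    (W : WeierstrassCurve ℚ) [W.IsElliptic] [W.IsGloballyMinimal]
    (hKimL : Kim2026.rankZero_le_padicValNat_sha_of_kuriharaNumber_ne_zero)
    (h48 : PerrinRiou2003.prop48_padicValRat_bsd_rank_zero_le)
    (hGZK : rank_eq_analyticRank_of_analyticRank_le_one) (hmod : hasEntireLFunction_rat)
    {rs : List TwistRecordK} (hrs : CertifiedK rs) {r : TwistRecordK} (hr' : r ∈ rs) [Fact r.p.Prime] [NeZero r.n]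
    (hν : r.n.primeFactors.card = r.primes.length)
    (hp5 : 5 ≤ r.p) (hX : ClassX7 W r.p) (hsurj : Surj W r.p) (hr : W.analyticRank = 0)
    {N : ℕ} [NeZero N] (D : ModularParametrizationData W N) (hc : ¬ (r.p : ℤ) ∣ D.maninConstant)
    (hper : ∃ u : ℚ, ‖(u : ℚ_[r.p])‖ = 1 ∧ W.realPeriodRat = u * plusPeriod D.f)
    (hk : 1 ≤ r.k) (hkt : r.k ≤ padicValNat r.p W.tamagawaProduct + 1)
    (hn : Kato.IsKolyvaginProduct W r.p r.k r.n)
    (hcyc : ∀ (ℓ : ℕ) [Fact ℓ.Prime], ℓ ∣ r.n →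
      Nat.card {P : ((WeierstrassCurve.integralModelInt W).map
          (Int.castRingHom (ZMod ℓ))).toAffine.Point // r.p • P = 0} ≤ r.p)
    {cs : List RoundingCert} (hcs : RoundingCertifiedHasseK r.k cs) {c : RoundingCert} (hcc : c ∈ cs)
    (hcp : c.p = r.p) (hcn : c.n = r.n) (hcden : c.den = r.den) (hcbins : c.bins = r.bins) (hD' : 0 < c.dstar)
    (ψ : (ℓ : ℕ) → (ZMod ℓ)ˣ →* Multiplicative (ZMod (r.p ^ r.k)))
    (hψ : ∀ ℓ ∈ r.n.primeFactors, Function.Surjective (ψ ℓ))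
    (hballL : ∀ (L : ZMod (r.p ^ r.k) → ℂ → ℂ), (∀ j, j ≠ 0 → Differentiable ℂ (L j)) →
      (∀ j, j ≠ 0 → ∀ s : ℂ, 2 < s.re → L j s = twistedLSeries D.f (binChar r.n ψ j)⁻¹ s) →
      ∀ k < r.p ^ r.k, ∃ mid rad : ℝ, rad ≤ (c.radNum : ℝ) / 10 ^ c.radExp ∧
        |mid - ((c.binsStar.getD k 0 : ℤ) : ℝ)| ≤ (c.marNum : ℝ) / 10 ^ c.marExp ∧
        |(c.dstar : ℝ) * ((r.components : ℝ) *
          (((∏ ℓ ∈ r.n.primeFactors, ((W.frobeniusTrace ℓ : ℂ) - 2)) * W.entireLFunction 1 +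
            ∑ j ∈ (Finset.univ : Finset (ZMod (r.p ^ r.k))).erase 0,
              ZMod.stdAddChar (-(j * (k : ZMod (r.p ^ r.k)))) *
                (gaussSum (binChar r.n ψ j) (ZMod.stdAddChar (N := r.n)) * L j 1)).re /
            ((r.p ^ r.k : ℕ) * plusPeriod D.f))) - mid| ≤ rad) :
    BSDp W r.p :=
  X7RankZero.bsdp_of_kimLower_of_prop48 W r.p hKimL h48 hGZK hmod hp5 hX hsurj hr D hc hper r.k r.n hk hkt hn hcyc ψ hψ
    (CertifiedK.kuriharaNumber_ne_zero_of_LValueBall hrs hr' hν D.isNewformOf (by omega)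
      (ClassX7.irr W r.p (by omega) hX) hX.1.1 hn hcs hcc hcp hcn hcden hcbins hD' ψ hψ hballL)

/-! ### §3 The literal-equation record shape (two-prime level `ℓ₁ℓ₂ ∈ 𝒩_k`) -/

/-- **N5 TAM-DEFECT RECORD SHAPE, STANDARD CURRENCY — `BSD(E, r.p)` on X7 ∧ `surj(r.p)` ∧ `r_an = 0` ∧ `r.p ≥ 5` from the literal
equation, a CYCLIC two-prime level `ℓ₁ℓ₂ = r.n ∈ 𝒩_{r.k}` certified in the kernel, a LANDED `CertifiedK` row `r` + `validHasseK r.k`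
rounding certificate `c` + the `L`-value enclosure `hballL`.**  Decidable inputs (per record): minimality (instance hypothesis; factored
Kraus per record), `r.p ∤ Δ`, `countPoints … r.p = n_p` with `r.p ∣ r.p + 1 − n_p` and an ADDITIVE prime `q ∣ Δ`, `q ∣ c₄` (class X7 via
`classX7_of_intModel`); `ℓᵢ ∤ Δ`, `ℓᵢ ≡ 1 (mod p^k)`, `countPoints … ℓᵢ = nᵢ`, `p^k ∣ nᵢ` (Kolyvagin primes of depth `k`); the two
CYCLICITY bounds `#Ẽ(𝔽_ℓᵢ)[p] ≤ p` in the literal-model form (`CyclicityLadder.card_torsion_le_of_ladder`).  REMAINING HYPOTHESES =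
EXACTLY `hKimL`, `h48` (PUBLISHED), `hGZK`, `hmod`; the data binders `hsurj` (Cremona `galrep` / prover B's certificate), `r_an = 0`,
`r.k ≤ ord_p ∏c_ℓ + 1` (Cremona), `D` with `p ∤ c_D`, the period transfer `hper`; a family `ψ` surjective at `ℓ₁, ℓ₂`; and `hballL`
(with `A = Π(a_ℓ − 2)` as an explicit integer).  Per pair; NOT a class theorem; nothing booked.
[cite: Kim2022StructureSelmer, Thm. 1.9 (6) (PDF p. 8), §1.2.2 (PDF p. 5) and §1.4.3 (PDF p. 7)] [cite: PerrinRiou2003, Prop. 4.8 (p. 162)]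
[cite: SilvermanAEC2009, VII.1 Remark 1.1, VII.5 Prop. 5.1(a) and (b)] [cite: IrelandRosen1990, Prop. 5.1.2 and §8.1]
[cite: MazurTateTeitelbaum1986Invent, §I.8 (8.6)] [cite: Miller2011LMS, Def. 1.1] -/
theorem X7RankZero.bsdp_of_kimLower_of_prop48_of_ainvs_of_certifiedK_of_LValueBall
    (hKimL : Kim2026.rankZero_le_padicValNat_sha_of_kuriharaNumber_ne_zero)
    (h48 : PerrinRiou2003.prop48_padicValRat_bsd_rank_zero_le)
    (hGZK : rank_eq_analyticRank_of_analyticRank_le_one) (hmod : hasEntireLFunction_rat)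
    (a1 a2 a3 a4 a6 : ℤ) (hmin : (⟨a1, a2, a3, a4, a6⟩ : WeierstrassCurve ℚ).IsGloballyMinimal)
    -- the landed depth-`k` record and its rounding certificate
    {rs : List TwistRecordK} (hrs : CertifiedK rs) {r : TwistRecordK} (hr' : r ∈ rs) [Fact r.p.Prime]
    (hν : r.primes.length = 2) (hp5 : 5 ≤ r.p) (hk : 1 ≤ r.k)
    {cs : List RoundingCert} (hcs : RoundingCertifiedHasseK r.k cs) {c : RoundingCert} (hcc : c ∈ cs)
    (hcp : c.p = r.p) (hcn : c.n = r.n) (hcden : c.den = r.den) (hcbins : c.bins = r.bins) (hD' : 0 < c.dstar)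
    -- class X7 at `r.p` from the model: good supersingular at `r.p` + an additive prime `q`; `surj(r.p)` is DATA
    (hpΔ : ¬ (r.p : ℤ) ∣ discOf [a1, a2, a3, a4, a6]) {np : ℕ} (hcnt : countPoints [a1, a2, a3, a4, a6] r.p = np)
    (hap : (r.p : ℤ) ∣ (r.p : ℤ) + 1 - np)
    (q : ℕ) (hq : q.Prime) (hqΔ : (q : ℤ) ∣ discOf [a1, a2, a3, a4, a6]) (hqc₄ : (q : ℤ) ∣ c4Of [a1, a2, a3, a4, a6])
    (hsurj : Surj (⟨a1, a2, a3, a4, a6⟩ : WeierstrassCurve ℚ) r.p)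
    -- the cyclic level `ℓ₁ℓ₂ = r.n ∈ 𝒩_k`
    (ℓ₁ ℓ₂ : ℕ) [Fact ℓ₁.Prime] [Fact ℓ₂.Prime] (hne : ℓ₁ ≠ ℓ₂) [NeZero r.n] (hrn : ℓ₁ * ℓ₂ = r.n)
    (hℓ₁p : ℓ₁ ≠ r.p) (hℓ₂p : ℓ₂ ≠ r.p) (hℓ₁2 : ℓ₁ ≠ 2) (hℓ₂2 : ℓ₂ ≠ 2)
    (hℓ₁Δ : ¬ (ℓ₁ : ℤ) ∣ discOf [a1, a2, a3, a4, a6]) (hℓ₂Δ : ¬ (ℓ₂ : ℤ) ∣ discOf [a1, a2, a3, a4, a6])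
    (h1₁ : ℓ₁ ≡ 1 [MOD r.p ^ r.k]) (h1₂ : ℓ₂ ≡ 1 [MOD r.p ^ r.k]) {n₁ n₂ : ℕ}
    (hc₁ : countPoints [a1, a2, a3, a4, a6] ℓ₁ = n₁) (hc₂ : countPoints [a1, a2, a3, a4, a6] ℓ₂ = n₂)
    (hd₁ : r.p ^ r.k ∣ n₁) (hd₂ : r.p ^ r.k ∣ n₂)
    (hcyc₁ : Nat.card {P : (((⟨a1, a2, a3, a4, a6⟩ : WeierstrassCurve ℤ)).map
        (Int.castRingHom (ZMod ℓ₁))).toAffine.Point // r.p • P = 0} ≤ r.p)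
    (hcyc₂ : Nat.card {P : (((⟨a1, a2, a3, a4, a6⟩ : WeierstrassCurve ℤ)).map
        (Int.castRingHom (ZMod ℓ₂))).toAffine.Point // r.p • P = 0} ≤ r.p)
    {A : ℤ} (hA : A = ((ℓ₁ : ℤ) + 1 - n₁ - 2) * ((ℓ₂ : ℤ) + 1 - n₂ - 2))
    -- data binders
    (hr0 : (⟨a1, a2, a3, a4, a6⟩ : WeierstrassCurve ℚ).analyticRank = 0)
    (hkt : r.k ≤ padicValNat r.p (⟨a1, a2, a3, a4, a6⟩ : WeierstrassCurve ℚ).tamagawaProduct + 1)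
    {N : ℕ} [NeZero N] (D : ModularParametrizationData (⟨a1, a2, a3, a4, a6⟩ : WeierstrassCurve ℚ) N)
    (hc : ¬ (r.p : ℤ) ∣ D.maninConstant)
    (hper : ∃ u : ℚ, ‖(u : ℚ_[r.p])‖ = 1 ∧
      (⟨a1, a2, a3, a4, a6⟩ : WeierstrassCurve ℚ).realPeriodRat = u * plusPeriod D.f)
    (ψ : (ℓ : ℕ) → (ZMod ℓ)ˣ →* Multiplicative (ZMod (r.p ^ r.k)))
    (hψ₁ : Function.Surjective (ψ ℓ₁)) (hψ₂ : Function.Surjective (ψ ℓ₂))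
    (hballL : ∀ (L : ZMod (r.p ^ r.k) → ℂ → ℂ), (∀ j, j ≠ 0 → Differentiable ℂ (L j)) →
      (∀ j, j ≠ 0 → ∀ s : ℂ, 2 < s.re → L j s = twistedLSeries D.f (binChar r.n ψ j)⁻¹ s) →
      ∀ k < r.p ^ r.k, ∃ mid rad : ℝ, rad ≤ (c.radNum : ℝ) / 10 ^ c.radExp ∧
        |mid - ((c.binsStar.getD k 0 : ℤ) : ℝ)| ≤ (c.marNum : ℝ) / 10 ^ c.marExp ∧
        |(c.dstar : ℝ) * ((r.components : ℝ) *
          (((A : ℂ) * (⟨a1, a2, a3, a4, a6⟩ : WeierstrassCurve ℚ).entireLFunction 1 +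
            ∑ j ∈ (Finset.univ : Finset (ZMod (r.p ^ r.k))).erase 0,
              ZMod.stdAddChar (-(j * (k : ZMod (r.p ^ r.k)))) *
                (gaussSum (binChar r.n ψ j) (ZMod.stdAddChar (N := r.n)) * L j 1)).re /
            ((r.p ^ r.k : ℕ) * plusPeriod D.f))) - mid| ≤ rad) :
    BSDp (⟨a1, a2, a3, a4, a6⟩ : WeierstrassCurve ℚ) r.p := by
  have h0 : discOf [a1, a2, a3, a4, a6] ≠ 0 := fun h ↦ hpΔ (by rw [h]; exact dvd_zero _)
  haveI := isElliptic_of_discOf_ne_zero a1 a2 a3 a4 a6 h0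
  haveI := hmin
  have hp2 : r.p ≠ 2 := by omega
  have hI : integralModelInt (⟨a1, a2, a3, a4, a6⟩ : WeierstrassCurve ℚ) = ⟨a1, a2, a3, a4, a6⟩ :=
    integralModelInt_eq_of_map_eq _ (map_mk_int a1 a2 a3 a4 a6)
  have hN₁ := natCard_point_eq_of_countPoints a1 a2 a3 a4 a6 ℓ₁ hℓ₁2 hℓ₁Δ hc₁
  have hN₂ := natCard_point_eq_of_countPoints a1 a2 a3 a4 a6 ℓ₂ hℓ₂2 hℓ₂Δ hc₂
  -- class X7 at `r.p`
  have hX : ClassX7 (⟨a1, a2, a3, a4, a6⟩ : WeierstrassCurve ℚ) r.p :=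
    classX7_of_intModel r.p hI (by rw [intCurve_Δ]; exact hpΔ)
      (natCard_point_eq_of_countPoints a1 a2 a3 a4 a6 r.p hp2 hpΔ hcnt) hap q hq
      (by rw [intCurve_Δ]; exact hqΔ) (by rw [intCurve_c₄]; exact hqc₄)
  -- the Kolyvagin level of depth `k`
  have hK₁ : Kato.IsKolyvaginPrime (⟨a1, a2, a3, a4, a6⟩ : WeierstrassCurve ℚ) r.p r.k ℓ₁ :=
    Additive.isKolyvaginPrime_of_intModel_of_card hI r.p r.k ℓ₁ hℓ₁p (by rw [intCurve_Δ]; exact hℓ₁Δ) h1₁ hN₁ hd₁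
  have hK₂ : Kato.IsKolyvaginPrime (⟨a1, a2, a3, a4, a6⟩ : WeierstrassCurve ℚ) r.p r.k ℓ₂ :=
    Additive.isKolyvaginPrime_of_intModel_of_card hI r.p r.k ℓ₂ hℓ₂p (by rw [intCurve_Δ]; exact hℓ₂Δ) h1₂ hN₂ hd₂
  have hn : Kato.IsKolyvaginProduct (⟨a1, a2, a3, a4, a6⟩ : WeierstrassCurve ℚ) r.p r.k r.n := by
    rw [← hrn]; exact Additive.isKolyvaginProduct_mul hK₁ hK₂ hne
  have hν' : r.n.primeFactors.card = r.primes.length := by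
    rw [← hrn, hν, Nat.primeFactors_mul (Fact.out : ℓ₁.Prime).ne_zero (Fact.out : ℓ₂.Prime).ne_zero,
      (Fact.out : ℓ₁.Prime).primeFactors, (Fact.out : ℓ₂.Prime).primeFactors,
      show ({ℓ₁} ∪ {ℓ₂} : Finset ℕ) = {ℓ₁, ℓ₂} from rfl, Finset.card_pair hne]
  -- cyclicity at both level primes, in the consumer's `integralModelInt` form
  have hcyc : ∀ (ℓ : ℕ) [Fact ℓ.Prime], ℓ ∣ r.n →
      Nat.card {P : ((WeierstrassCurve.integralModelInt (⟨a1, a2, a3, a4, a6⟩ : WeierstrassCurve ℚ)).map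
          (Int.castRingHom (ZMod ℓ))).toAffine.Point // r.p • P = 0} ≤ r.p := by
    rw [hI]
    exact forall_card_torsion_le_of_level ⟨a1, a2, a3, a4, a6⟩ r.p r.n ℓ₁ ℓ₂ hrn.symm hcyc₁ hcyc₂
  have hψ : ∀ ℓ ∈ r.n.primeFactors, Function.Surjective (ψ ℓ) := by
    rw [← hrn]; exact surjective_family_of_mem_primeFactors_mul Fact.out Fact.out ψ hψ₁ hψ₂
  -- `A = Π_{ℓ ∣ n} (a_ℓ − 2)`
  have hprod : (∏ ℓ ∈ r.n.primeFactors,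
      (((⟨a1, a2, a3, a4, a6⟩ : WeierstrassCurve ℚ).frobeniusTrace ℓ : ℂ) - 2)) = (A : ℂ) := by
    rw [← hrn]; exact prod_primeFactors_frobeniusTrace_sub_two_eq hI Fact.out Fact.out hne hN₁ hN₂ hA
  refine X7RankZero.bsdp_of_kimLower_of_prop48_of_certifiedK_of_LValueBall _ hKimL h48 hGZK hmod hrs hr' hν' hp5 hX hsurj
    hr0 D hc hper hk hkt hn hcyc hcs hcc hcp hcn hcden hcbins hD' ψ hψ ?_
  intro L hL hL' k hk
  obtain ⟨mid, rad, h1, h2, h3⟩ := hballL L hL hL' k hk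
  refine ⟨mid, rad, h1, h2, ?_⟩
  rw [hprod]
  exact h3

end Summit.BirchSwinnertonDyer.Rank1Residual.Supersingular

end
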